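import Summits.Ventures.PercRepro.RLSRuleSixClassify

/-!
# C-025 at q = 3 on every core matroid of rank `p ≥ 8` — unconditionally; the `(8, 3)` core cell (night-3, gen 4)

`R3PlusPerFlat p` holds for every `p ≥ 8` (`R3PlusPerFlat_holds`: the `𝒯₀` planes by `perFlat_T0_all`, the `6`-point
planes by `classify_six` and the three shape theorems), so the per-flat transfer `c025_of_perFlat_normalized` gives
`ThmN.RLS M p 3` on every core matroid of rank `p ≥ 8` with NO remaining hypothesis (`rls_core_of_eight_le`).  In
particular the `(8, 3)` core cell of p2's `SmallCoreCellsSevenEight` is a theorem (`c025_eight_three_core`, p2's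
verbatim shape), and `SmallCoreCellsSevenEight` itself follows from the `(7, 3)` core alone
(`smallCoreCells_seven_eight_of_seven`) — the two reductions of the cell (night-3's `c025_three_of_seven`, p2's
`c025_three_of_sevenEight`) now rest on the same single statement.
Imports `RLSRuleSixClassify`.  Axioms: standard.
-/

open scoped Matroid

namespace PercRepro

namespace NightThree

open Finset ThmH PerFlat

/-- **`R₃⁺` per flat for every `p ≥ 8`** — the lane's per-flat theorem, assembled. -/
theorem R3PlusPerFlat_holds {p : ℕ} (hp : 8 ≤ p) : R3PlusPerFlat p :=
  R3PlusPerFlat_of_big hp (R3PlusPerFlatBig_of_six (R3PlusPerFlatSix_holds hp))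

/-- **C-025 at `q = 3` on every core matroid of rank `p ≥ 8`**, with no remaining hypothesis. -/
theorem rls_core_of_eight_le {α : Type} (M : Matroid α) [M.Finite] {p : ℕ} (hp : 8 ≤ p) (hc : Core M p) :
    ThmN.RLS M p 3 := by
  classical
  unfold ThmN.RLS
  exact c025_of_perFlat_normalized M p 3 (phiK_nonneg p 3) (fPlus M) (fPlus_nonneg M) (R3PlusPerFlat_holds hp M hc)

/-- **The `(8, 3)` core cell** in the verbatim shape of p2's `SmallCoreCellsSevenEight`. -/
theorem c025_eight_three_core {α : Type} (M : Matroid α) [M.Finite]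
    (hs : ∀ e ∈ M.E, ∀ f ∈ M.E, e ≠ f → M.eRk {e, f} = 2) (hr : M.eRank = 8) (hc : ∀ e, ¬ M.IsColoop e)
    (hfree : ∀ e ∈ M.E, ∃ A ⊆ M.E \ {e}, e ∉ M.closure A ∧ e ∉ M.closure ((M.E \ {e}) \ A)) :
    ThmN.RLS M 8 3 :=
  rls_core_of_eight_le M (le_refl 8) ⟨hs, by exact_mod_cast hr, hc, hfree⟩

/-- p2's `SmallCoreCellsSevenEight` (its statement verbatim) from the `(7, 3)` core alone. -/
theorem smallCoreCells_seven_eight_of_seven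
    (hseven : ∀ {α : Type} (M : Matroid α) [M.Finite], Core M 7 → ThmN.RLS M 7 3) :
    ∀ {α : Type} (M : Matroid α) [M.Finite] (p : ℕ), (p = 7 ∨ p = 8) →
      (∀ e ∈ M.E, ∀ f ∈ M.E, e ≠ f → M.eRk {e, f} = 2) → M.eRank = (p : ℕ∞) →
      (∀ e, ¬ M.IsColoop e) →
      (∀ e ∈ M.E, ∃ A ⊆ M.E \ {e}, e ∉ M.closure A ∧ e ∉ M.closure ((M.E \ {e}) \ A)) →
      ThmN.RLS M p 3 := by
  intro α M _ p hp hs hr hc hfree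
  rcases hp with rfl | rfl
  · exact hseven M ⟨hs, hr, hc, hfree⟩
  · exact rls_core_of_eight_le M (le_refl 8) ⟨hs, hr, hc, hfree⟩

end NightThree

end PercRepro
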